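import Literature.MathematicalPhysics.KineticTheory.HardSphereEulerProofs
import Literature.MathematicalPhysics.KineticTheory.HardSphereBBGKYLiouvilleFlow
import Literature.Analysis.FluidPDE.HardSphereMomentumConservation
import Literature.Analysis.FluidPDE.BoltzmannGradLimitProofs
import HarnessLib

/-!
# Rung 0 of the crux line `equilibrium-rung-mean-variance` (`JParityClosure.OddContactSymmetry`,
# stmt-AtomisticToContinuum-13078): the homogeneous Gibbs law is invariant under every hard-sphere flow

Helper file of the lead prover for the registered stub `stub_meanParity` (S3) of the line
`Cruxes/OddContactSymmetry/Lines/equilibrium-rung-mean-variance.lean` (and equally for S1, S2, S4 at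
rung 0).  RUNG 0 = constant profiles `(a₀, u₀, θ₀) ≡ (a, u, θ)`: then the local Gibbs law
`localGibbsLaw σ a u θ N Φ` is the canonical (homogeneous) Gibbs law of `N + 1` hard spheres, and the
first step of every rung-0 argument of the line is its STATIONARITY under the deterministic dynamics:
`(Φ_t)_# G_N = G_N` for every hard-sphere flow `Φ` and every time `t` — so that the evolved law
`μ_t = (Φ_t)_# LG₀` in S3/S4 is the static Gibbs law and the tube functional's mean / variance become
static equilibrium quantities.  This is Liouville's theorem (`HardSphereFlow.measurePreserving`) plus
conservation of kinetic energy and momentum along good orbits (`HardSphereFlow.configEnergy_flow`,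
`HardSphereFlow.configMomentum_flow`): the Gibbs density `Z⁻¹ 𝟙_D ∏ᵢ a M_{1,u,θ}(vᵢ)` is a function of
`∑ᵢ ‖vᵢ − u‖² = 2E − 2⟪P, u⟫ + (N+1)‖u‖²` only.  It was so far only an explicit HYPOTHESIS in the tree
(`hΦ : MeasurePreserving (Φ.flow t) G_N G_N` in `HardSphereTwoTimePressure.lean`); here it is proved.

Main results: `tensorPow_localGibbsProfile_const` (closed form of the homogeneous Gibbs weight),
`tensorPow_localGibbsProfile_const_flow` (its invariance along good orbits),
`map_flow_localGibbsLaw_const` (`(Φ_t)_# G_N = G_N`) and `measurePreserving_flow_localGibbsLaw_const`.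

References: H. Spohn, *Large Scale Dynamics of Interacting Particles* (1991), Part I §2.3 (equilibrium
measures are invariant under the dynamics); GST 2013 Prop. 4.1.1 (Liouville measure preserved).
-/

noncomputable section

open MeasureTheory Set
open scoped ENNReal InnerProductSpace BigOperators

namespace Summit.AtomisticToContinuum.HydrodynamicLimit.Theorems

open Literature.Analysis.FluidPDE Literature.MathematicalPhysics.KineticTheory

/-- `∑ᵢ ‖vᵢ − u‖² = 2 E(z) − 2 ⟪P(z), u⟫ + n ‖u‖²` for an `n`-particle configuration `z` with kinetic
energy `E = ½ ∑ ‖vᵢ‖²` and momentum `P = ∑ vᵢ`. [folklore] -/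
theorem sum_norm_vel_sub_sq_eq {n : ℕ} (z : Config n (Fin 3) T3) (u : V3) :
    ∑ i, ‖(z i).2 - u‖ ^ 2 =
      2 * configEnergy z - 2 * ⟪configMomentum z, u⟫_ℝ + n * ‖u‖ ^ 2 := by
  simp only [configEnergy, configMomentum, sum_inner, norm_sub_sq_real, Finset.sum_add_distrib,
    Finset.sum_sub_distrib, Finset.sum_const, Finset.card_univ, Fintype.card_fin, nsmul_eq_mul,
    Finset.mul_sum]
  ring

/-- **Closed form of the homogeneous Gibbs weight.** For CONSTANT profiles `(a, u, θ)` the tensor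
power of the local Gibbs profile is `(a c_θ)ⁿ exp(−∑ᵢ‖vᵢ − u‖²/(2θ))`,
`c_θ = (2πθ)^{−d/2}`. [folklore] -/
theorem tensorPow_localGibbsProfile_const (a θ : ℝ) (u : V3) {n : ℕ} (z : Config n (Fin 3) T3) :
    tensorPow n (localGibbsProfile (fun _ => a) (fun _ => u) (fun _ => θ)) z =
      (a * (2 * Real.pi * θ) ^ (-(Module.finrank ℝ V3 : ℝ) / 2)) ^ n *
        Real.exp (-(∑ i, ‖(z i).2 - u‖ ^ 2) / (2 * θ)) := by
  simp only [tensorPow, localGibbsProfile, localMaxwellian, one_mul]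
  rw [show (∏ i, a * ((2 * Real.pi * θ) ^ (-(Module.finrank ℝ V3 : ℝ) / 2) *
      Real.exp (-‖(z i).2 - u‖ ^ 2 / (2 * θ)))) =
      ∏ i, ((a * (2 * Real.pi * θ) ^ (-(Module.finrank ℝ V3 : ℝ) / 2)) *
        Real.exp (-‖(z i).2 - u‖ ^ 2 / (2 * θ))) from
      Finset.prod_congr rfl fun i _ => by ring]
  rw [Finset.prod_mul_distrib, Finset.prod_const, Finset.card_univ, Fintype.card_fin,
    ← Real.exp_sum]
  congr 1
  congr 1
  rw [neg_div, Finset.sum_div, ← Finset.sum_neg_distrib]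
  refine Finset.sum_congr rfl fun i _ => ?_
  ring

/-- **The homogeneous Gibbs weight is invariant along good orbits**: energy and momentum are
conserved by the hard-sphere flow, and the weight depends on the velocities only through
`∑ᵢ‖vᵢ − u‖² = 2E − 2⟪P,u⟫ + (N+1)‖u‖²`. [folklore] -/
theorem tensorPow_localGibbsProfile_const_flow (a θ : ℝ) (u : V3) {σ : ℝ} {N : ℕ}
    (Φ : HardSphereFlow (Torus.geometry (Fin 3)) (hsDiameter σ N) (N + 1))
    {z : Config (N + 1) (Fin 3) T3} (hz : z ∈ Φ.good) (t : ℝ) :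
    tensorPow (N + 1) (localGibbsProfile (fun _ => a) (fun _ => u) (fun _ => θ)) (Φ.flow t z) =
      tensorPow (N + 1) (localGibbsProfile (fun _ => a) (fun _ => u) (fun _ => θ)) z := by
  rw [tensorPow_localGibbsProfile_const, tensorPow_localGibbsProfile_const, sum_norm_vel_sub_sq_eq,
    sum_norm_vel_sub_sq_eq, Φ.configEnergy_flow hz t, Φ.configMomentum_flow hz t]

/-- The canonical (homogeneous) Gibbs density is invariant along good orbits (the hard-sphere domain
indicator is invariant too: good orbits stay in the good set `⊆ D`). [folklore] -/
theorem canonicalDensity_const_flow (a θ : ℝ) (u : V3) {σ : ℝ} {N : ℕ}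
    (Φ : HardSphereFlow (Torus.geometry (Fin 3)) (hsDiameter σ N) (N + 1))
    {z : Config (N + 1) (Fin 3) T3} (hz : z ∈ Φ.good) (t : ℝ) :
    canonicalDensity (Torus.geometry (Fin 3)) (hsDiameter σ N) (N + 1)
        (localGibbsProfile (fun _ => a) (fun _ => u) (fun _ => θ)) (Φ.flow t z) =
      canonicalDensity (Torus.geometry (Fin 3)) (hsDiameter σ N) (N + 1)
        (localGibbsProfile (fun _ => a) (fun _ => u) (fun _ => θ)) z := by
  have hzt : Φ.flow t z ∈ Φ.good := Φ.mapsTo_good t hz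
  simp only [canonicalDensity, indicator_of_mem (Φ.good_subset hz),
    indicator_of_mem (Φ.good_subset hzt), tensorPow_localGibbsProfile_const_flow a θ u Φ hz t]

/-- **Stationarity of the homogeneous Gibbs law under the hard-sphere dynamics** (rung 0 of the line
`equilibrium-rung-mean-variance`): for constant profiles `(a, u, θ)`, every reduced diameter `σ`, every
particle number and EVERY hard-sphere flow `Φ`, the push-forward of `G_N = localGibbsLaw σ a u θ N Φ`
under `Φ_t` is `G_N` itself.  Proof: by the mild Liouville equation (`map_flow_particleLaw`) the
time-`t` law has Lebesgue density `𝟙_good · W ∘ Φ_{−t}`, `W` the canonical density; on the good set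
`W ∘ Φ_{−t} = W` (`canonicalDensity_const_flow`), and `good` is Lebesgue-conull inside the hard-sphere
domain, off which `W = 0`. No hypothesis on `a, θ, σ` is needed (for `θ ≤ 0` or overlapping spheres
both sides are the same junk/zero measure). [folklore] -/
theorem map_flow_localGibbsLaw_const (σ a θ : ℝ) (u : V3) (N : ℕ)
    (Φ : HardSphereFlow (Torus.geometry (Fin 3)) (hsDiameter σ N) (N + 1)) (t : ℝ) :
    (localGibbsLaw σ (fun _ => a) (fun _ => u) (fun _ => θ) N Φ).map (Φ.flow t) =
      localGibbsLaw σ (fun _ => a) (fun _ => u) (fun _ => θ) N Φ := by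
  set W := canonicalDensity (Torus.geometry (Fin 3)) (hsDiameter σ N) (N + 1)
    (localGibbsProfile (fun _ => a) (fun _ => u) (fun _ => θ)) with hW
  have hWm : Measurable W :=
    measurable_canonicalDensity _ _
      (measurable_localGibbsProfile continuous_const continuous_const continuous_const)
  have hWD : ∀ z ∉ hardSphereDomain (Torus.geometry (Fin 3)) (N + 1) (hsDiameter σ N), W z = 0 :=
    fun _ hz => canonicalDensity_eq_zero_of_notMem _ _ _ _ hz
  have hlaw : localGibbsLaw σ (fun _ => a) (fun _ => u) (fun _ => θ) N Φ = particleLaw Φ W := rfl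
  rw [hlaw, map_flow_particleLaw Φ hWm t, particleLaw_eq_withDensity Φ hWD]
  refine withDensity_congr_ae ?_
  -- the bad set `D \ good` is Lebesgue-null
  have hnull : volume (hardSphereDomain (Torus.geometry (Fin 3)) (N + 1) (hsDiameter σ N) \ Φ.good)
      = 0 := by
    have h := Φ.measure_compl_good
    rw [liouville_eq, Measure.restrict_apply' (measurableSet_hardSphereDomain _
      Torus.measurable_geometry_sepVec (N + 1) (hsDiameter σ N))] at h
    have hset : hardSphereDomain (Torus.geometry (Fin 3)) (N + 1) (hsDiameter σ N) \ Φ.good =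
        Φ.goodᶜ ∩ hardSphereDomain (Torus.geometry (Fin 3)) (N + 1) (hsDiameter σ N) := by
      ext z
      simp only [mem_sdiff, mem_inter_iff, mem_compl_iff, and_comm]
    rwa [hset]
  filter_upwards [compl_mem_ae_iff.2 hnull] with z hz
  by_cases hg : z ∈ Φ.good
  · rw [indicator_of_mem hg, hsTransport_apply]
    congr 1
    exact canonicalDensity_const_flow a θ u Φ hg (-t)
  · have hzD : z ∉ hardSphereDomain (Torus.geometry (Fin 3)) (N + 1) (hsDiameter σ N) :=
      fun hD => hz ⟨hD, hg⟩
    rw [indicator_of_notMem hg, hWD z hzD]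

/-- **Every hard-sphere flow map preserves the homogeneous Gibbs law** (`MeasurePreserving` form of
`map_flow_localGibbsLaw_const`; this is the hypothesis `hΦ` of `hsTwoTimePressure_zero_left` &c. in
`HardSphereTwoTimePressure.lean`, now discharged). [folklore] -/
theorem measurePreserving_flow_localGibbsLaw_const (σ a θ : ℝ) (u : V3) (N : ℕ)
    (Φ : HardSphereFlow (Torus.geometry (Fin 3)) (hsDiameter σ N) (N + 1)) (t : ℝ) :
    MeasurePreserving (Φ.flow t) (localGibbsLaw σ (fun _ => a) (fun _ => u) (fun _ => θ) N Φ)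
      (localGibbsLaw σ (fun _ => a) (fun _ => u) (fun _ => θ) N Φ) :=
  ⟨Φ.measurable_flow t, map_flow_localGibbsLaw_const σ a θ u N Φ t⟩

/-- **Stationarity of expectations at rung 0**: for constant profiles, every flow, every time `t`
and every a.e.-strongly measurable observable `f`, `∫ f (Φ_t z) dG_N = ∫ f dG_N` — e.g. the mean of
the fixed-time tube functional `A_t ∘ Φ_t` of the line under the Gibbs law is the STATIC Gibbs mean
of `A_t`. [folklore] -/
theorem integral_comp_flow_localGibbsLaw_const (σ a θ : ℝ) (u : V3) (N : ℕ)
    (Φ : HardSphereFlow (Torus.geometry (Fin 3)) (hsDiameter σ N) (N + 1)) (t : ℝ)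
    {f : Config (N + 1) (Fin 3) T3 → ℝ}
    (hf : AEStronglyMeasurable f (localGibbsLaw σ (fun _ => a) (fun _ => u) (fun _ => θ) N Φ)) :
    ∫ z, f (Φ.flow t z) ∂(localGibbsLaw σ (fun _ => a) (fun _ => u) (fun _ => θ) N Φ) =
      ∫ z, f z ∂(localGibbsLaw σ (fun _ => a) (fun _ => u) (fun _ => θ) N Φ) := by
  have h := measurePreserving_flow_localGibbsLaw_const σ a θ u N Φ t
  have hf' : AEStronglyMeasurable f
      ((localGibbsLaw σ (fun _ => a) (fun _ => u) (fun _ => θ) N Φ).map (Φ.flow t)) := by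
    rwa [h.map_eq]
  rw [← integral_map (Φ.measurable_flow t).aemeasurable hf', h.map_eq]

/-- **Stationarity of second moments / probabilities at rung 0** (`lintegral` form, no measurability
of the observable needed beyond measurability of `g`): `∫⁻ g (Φ_t z) dG_N = ∫⁻ g dG_N`. [folklore] -/
theorem lintegral_comp_flow_localGibbsLaw_const (σ a θ : ℝ) (u : V3) (N : ℕ)
    (Φ : HardSphereFlow (Torus.geometry (Fin 3)) (hsDiameter σ N) (N + 1)) (t : ℝ)
    {g : Config (N + 1) (Fin 3) T3 → ℝ≥0∞} (hg : Measurable g) :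
    ∫⁻ z, g (Φ.flow t z) ∂(localGibbsLaw σ (fun _ => a) (fun _ => u) (fun _ => θ) N Φ) =
      ∫⁻ z, g z ∂(localGibbsLaw σ (fun _ => a) (fun _ => u) (fun _ => θ) N Φ) :=
  (measurePreserving_flow_localGibbsLaw_const σ a θ u N Φ t).lintegral_comp hg

/-- **Events transported by the flow keep their Gibbs probability at rung 0**:
`G_N (Φ_t ⁻¹ A) = G_N A` for measurable `A`. [folklore] -/
theorem localGibbsLaw_const_preimage_flow (σ a θ : ℝ) (u : V3) (N : ℕ)
    (Φ : HardSphereFlow (Torus.geometry (Fin 3)) (hsDiameter σ N) (N + 1)) (t : ℝ)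
    {A : Set (Config (N + 1) (Fin 3) T3)} (hA : MeasurableSet A) :
    localGibbsLaw σ (fun _ => a) (fun _ => u) (fun _ => θ) N Φ (Φ.flow t ⁻¹' A) =
      localGibbsLaw σ (fun _ => a) (fun _ => u) (fun _ => θ) N Φ A :=
  (measurePreserving_flow_localGibbsLaw_const σ a θ u N Φ t).measure_preimage
    hA.nullMeasurableSet

/-- **Registered helper stub `stub_gibbsInvarianceRung0`** of crux stmt-AtomisticToContinuum-13078 (rung 0
of `stub_meanParity`, line `equilibrium-rung-mean-variance`): for constant profiles the local Gibbs law is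
invariant under every hard-sphere flow map, `(Φ_t)_# G_N = G_N` (= `map_flow_localGibbsLaw_const` in
signature form). [folklore] -/
theorem stub_gibbsInvarianceRung0 :
    ∀ (σ a θ : ℝ) (u : V3) (N : ℕ)
      (Φ : HardSphereFlow (Torus.geometry (Fin 3)) (hsDiameter σ N) (N + 1)) (t : ℝ),
      (localGibbsLaw σ (fun _ => a) (fun _ => u) (fun _ => θ) N Φ).map (Φ.flow t) =
        localGibbsLaw σ (fun _ => a) (fun _ => u) (fun _ => θ) N Φ :=
  map_flow_localGibbsLaw_const

end Summit.AtomisticToContinuum.HydrodynamicLimit.Theorems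

end
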